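import Literature.NumberTheory.EllipticCurves.BSDSelmerCMPConverseHeegnerFieldProofs
import Mathlib.FieldTheory.Finite.GaloisField
import Mathlib.LinearAlgebra.Eigenspace.Minpoly
import HarnessLib

/-!
# Two lemmas for `E(F)[p] = 0` over (G)-fields: a stable line for a commuting family of exponent `∣ p − 1` on `𝔽_p²`, and the restriction `Γ_ℚ → Gal(K/ℚ)`

HONEST FRAMING (cell `b2b-bsdres`, run/shared/lean/b2b/bsd-rank1-residual/, verbatim in every
file): the goal of the cell is to DELETE the COMBINATION-SHAPED residual classes of the
Birch–Swinnerton-Dyer formula for ALL analytic-rank `≤ 1` elliptic curves over `ℚ` — "full BSD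
formula for every rank `≤ 1` curve in class `C`" assembled STRICTLY from published theorems — so
that the rank-`≤ 1` remainder becomes exactly the CONSTRUCTION-SHAPED classes, which are TYPED
(missing-input `Prop`s), NOT attempted. This is not "finishing BSD". Sub-cell `additive-p2`
(X3♯(G-ord) / X4♯(G-ord)), generation 11: research route; no claim beyond the stated classes;
theorems only, no definition, no named fact, nothing booked, no label moved.

Support file of `Additive/GordTorsionFree.lean` (`E(K)[p] = 0` over abelian `K` of degree
`∣ p − 1` for irreducible `E[p]`), split off for the 400-line rule:

* `splits_X_pow_sub_X` — `X^p − X` splits over `𝔽_p` (Mathlib `FiniteField.isSplittingField_sub`);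
* `exists_stable_addSubgroup_of_comm_of_pow_smul` — **the linear algebra**: a group acting on an
  abelian group `M` with `pM = 0`, `#M = p²`, COMMUTATIVELY and with `g^{p−1} = 1` for all `g`, has a
  proper non-zero stable subgroup (a line): either every `g` is a scalar (any line), or some
  non-scalar `g`, killed by `X^p − X = ∏_{a ∈ 𝔽_p}(X − a)`, has a split minimal polynomial, hence an
  eigenvalue in `𝔽_p` (Mathlib `Module.End.hasEigenvalue_of_isRoot`), and its eigenspace is proper,
  non-zero and stable under everything commuting with `g`;
* `exists_restrictNormalHom` — **the Galois bookkeeping**: for a normal number field `K`, a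
  homomorphism `r : Γ_ℚ → Gal(K/ℚ)` through which `Γ_ℚ` acts on the embedded copy of `K` in `ℚ̄`
  used by the tree's `exists_resGal_eq_of_forall_apply_eq` (Mathlib `AlgEquiv.restrictNormalHom`
  for the algebra structure given by that embedding).

References: J.-P. Serre, *Galois Cohomology* II.§1.1; J. S. Milne, *Fields and Galois Theory* §7;
any linear algebra text (commuting diagonalisable operators share an eigenvector).
-/

noncomputable section

open scoped Classical

open WeierstrassCurve Polynomial

namespace Summit.BirchSwinnertonDyer.Rank1Residual.Additive

/-! ## Part A. Linear algebra: a commutative action of exponent dividing `p − 1` on `𝔽_p²` fixes a line -/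

section Abstract

/-- `X^p − X` splits over `𝔽_p` (it is `∏_{a ∈ 𝔽_p} (X − a)`; Mathlib's
`FiniteField.isSplittingField_sub`). -/
theorem splits_X_pow_sub_X (p : ℕ) [Fact p.Prime] :
    (X ^ p - X : (ZMod p)[X]).Splits := by
  have h := (FiniteField.isSplittingField_sub (ZMod p) (ZMod p)).splits
  rw [ZMod.card] at h
  simpa using h

/-- **A commuting family of automorphisms of exponent dividing `p − 1` of a group of order `p²`
and exponent `p` has a proper non-zero stable subgroup.** Let a group `G` act on an abelian group
`M` with `p·M = 0` and `#M = p²` (an `𝔽_p`-plane), commutatively (`(ab)·x = (ba)·x`) and with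
`g^{p−1}` acting trivially for every `g`. Then some subgroup `0 ≠ H ≠ M` is `G`-stable: if every
`g` acts as a scalar, any line is stable; otherwise some `g` is a non-scalar endomorphism killed by
`X^p − X = ∏_{a ∈ 𝔽_p}(X − a)`, so its minimal polynomial splits over `𝔽_p` and `g` has an
eigenvalue `μ ∈ 𝔽_p` (Mathlib `Module.End.hasEigenvalue_of_isRoot`); the eigenspace
`ker(g − μ)` is non-zero, proper (`g` is not the scalar `μ`) and stable under everything commuting
with `g`. (The linear algebra behind "`E(K)[p] = 0` over an abelian field `K` of degree dividing
`p − 1` when `E[p]` is irreducible".) [folklore] -/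
theorem exists_stable_addSubgroup_of_comm_of_pow_smul {G M : Type*} [Group G] [AddCommGroup M]
    [DistribMulAction G M] {p : ℕ} [hp : Fact p.Prime] (hpM : ∀ x : M, p • x = 0)
    (hcard : Nat.card M = p ^ 2) (comm : ∀ (a b : G) (x : M), (a * b) • x = (b * a) • x)
    (hpow : ∀ (g : G) (x : M), (g ^ (p - 1)) • x = x) :
    ∃ H : AddSubgroup M, (∀ g : G, ∀ x ∈ H, g • x ∈ H) ∧ H ≠ ⊥ ∧ H ≠ ⊤ := by
  haveI : Module (ZMod p) M := AddCommGroup.zmodModule hpM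
  have hfin : Finite M := Nat.finite_of_card_ne_zero (by rw [hcard]; exact pow_ne_zero 2 hp.out.ne_zero)
  haveI : Module.Finite (ZMod p) M := Module.Finite.of_finite
  -- scalars `a : ZMod p` act through `ℕ`, hence commute with `G`
  have hsmulG : ∀ (g : G) (a : ZMod p) (x : M), g • (a • x) = a • (g • x) := by
    intro g a x
    rw [← ZMod.natCast_zmod_val a, Nat.cast_smul_eq_nsmul, Nat.cast_smul_eq_nsmul]
    exact map_nsmul (DistribSMul.toAddMonoidHom M g) a.val x
  -- a non-zero element, and every line is proper (`p < p²`)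
  have hnt : ∃ x₀ : M, x₀ ≠ 0 := by
    by_contra! h
    have h1 : Nat.card M = 1 := Nat.card_eq_one_iff_exists.mpr ⟨0, fun x ↦ h x⟩
    rw [hcard] at h1
    exact absurd h1 (ne_of_gt (Nat.one_lt_pow two_ne_zero hp.out.one_lt))
  have hline : ∀ x₀ : M, ((ZMod p) ∙ x₀).toAddSubgroup ≠ ⊤ := by
    intro x₀ htop
    have hsurj : Function.Surjective (fun a : ZMod p ↦ (⟨a • x₀, Submodule.mem_span_singleton.mpr
        ⟨a, rfl⟩⟩ : ↥((ZMod p) ∙ x₀))) := by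
      rintro ⟨y, hy⟩
      obtain ⟨a, rfl⟩ := Submodule.mem_span_singleton.mp hy
      exact ⟨a, rfl⟩
    have hle : Nat.card ((ZMod p) ∙ x₀) ≤ Nat.card (ZMod p) := Nat.card_le_card_of_surjective _ hsurj
    have heq : Nat.card ((ZMod p) ∙ x₀) = Nat.card M := by
      rw [← AddSubgroup.card_top (G := M), ← htop]; rfl
    rw [heq, hcard, Nat.card_zmod] at hle
    have : p < p ^ 2 := by
      calc p = p ^ 1 := (pow_one p).symm
        _ < p ^ 2 := Nat.pow_lt_pow_right hp.out.one_lt (by norm_num)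
    omega
  by_cases hscalar : ∀ g : G, ∃ a : ZMod p, ∀ x : M, g • x = a • x
  · -- every `g` is a scalar: any line is stable
    obtain ⟨x₀, hx₀⟩ := hnt
    refine ⟨((ZMod p) ∙ x₀).toAddSubgroup, fun g x hx ↦ ?_, fun hbot ↦ hx₀ ?_, hline x₀⟩
    · obtain ⟨a, ha⟩ := hscalar g
      have hx' : x ∈ (ZMod p) ∙ x₀ := (Submodule.mem_toAddSubgroup _).mp hx
      rw [Submodule.mem_toAddSubgroup, ha x]
      exact Submodule.smul_mem _ a hx'
    · have hmem : x₀ ∈ ((ZMod p) ∙ x₀).toAddSubgroup := Submodule.mem_span_singleton_self x₀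
      rw [hbot] at hmem
      exact (AddSubgroup.mem_bot).mp hmem
  · -- a non-scalar `g`: one of its eigenspaces
    push Not at hscalar
    obtain ⟨g, hg⟩ := hscalar
    obtain ⟨x₀, hx₀⟩ := hnt
    haveI : Nontrivial M := ⟨⟨x₀, 0, hx₀⟩⟩
    -- `g` as an `𝔽_p`-linear endomorphism
    let L : Module.End (ZMod p) M :=
      { toFun := fun x ↦ g • x
        map_add' := fun x y ↦ smul_add g x y
        map_smul' := fun a x ↦ hsmulG g a x }
    have hL : ∀ x, L x = g • x := fun _ ↦ rfl
    -- `L^p = L`, so the minimal polynomial divides `X^p − X`, which splits over `𝔽_p`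
    have hLpow : ∀ (n : ℕ) (x : M), (L ^ n) x = (g ^ n) • x := by
      intro n x
      induction n with
      | zero => simp
      | succ n ih => rw [pow_succ', pow_succ', Module.End.mul_apply, ih, hL, mul_smul]
    have haeval : aeval L (X ^ p - X : (ZMod p)[X]) = 0 := by
      ext x
      rw [map_sub, map_pow, aeval_X, LinearMap.sub_apply, LinearMap.zero_apply, hLpow, hL,
        sub_eq_zero]
      have hp1 : p = (p - 1) + 1 := (Nat.sub_add_cancel hp.out.one_le).symm
      conv_lhs => rw [hp1, pow_succ, mul_smul, hpow]
    have hdvd : minpoly (ZMod p) L ∣ (X ^ p - X : (ZMod p)[X]) := minpoly.dvd _ _ haeval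
    have hne : (X ^ p - X : (ZMod p)[X]) ≠ 0 :=
      FiniteField.X_pow_card_sub_X_ne_zero (ZMod p) hp.out.one_lt
    have hsplit : (minpoly (ZMod p) L).Splits := (splits_X_pow_sub_X p).of_dvd hne hdvd
    have hdeg : (minpoly (ZMod p) L).degree ≠ 0 :=
      (minpoly.degree_pos (Algebra.IsIntegral.isIntegral L)).ne'
    obtain ⟨μ, hμ⟩ := hsplit.exists_eval_eq_zero hdeg
    have heig : Module.End.HasEigenvalue L μ := Module.End.hasEigenvalue_of_isRoot hμ
    -- the eigenspace
    refine ⟨(Module.End.eigenspace L μ).toAddSubgroup, fun h x hx ↦ ?_, fun hbot ↦ ?_, fun htop ↦ ?_⟩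
    · rw [Submodule.mem_toAddSubgroup, Module.End.mem_eigenspace_iff, hL] at hx ⊢
      rw [← mul_smul, comm, mul_smul, hx, hsmulG]
    · apply heig
      rw [Submodule.eq_bot_iff]
      intro x hx
      have hx' : x ∈ (Module.End.eigenspace L μ).toAddSubgroup :=
        (Submodule.mem_toAddSubgroup _).mpr hx
      rw [hbot] at hx'
      exact (AddSubgroup.mem_bot).mp hx'
    · obtain ⟨x, hx⟩ := hg μ
      apply hx
      have hxH : x ∈ (Module.End.eigenspace L μ).toAddSubgroup := htop ▸ AddSubgroup.mem_top x
      rw [Submodule.mem_toAddSubgroup, Module.End.mem_eigenspace_iff, hL] at hxH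
      exact hxH

end Abstract

/-! ## Part B. Galois bookkeeping: restriction `Γ_ℚ → Gal(K/ℚ)` along the tree's embedding `K ↪ ℚ̄` -/

section Galois

open Field (absoluteGaloisGroup)
open Field.absoluteGaloisGroup (toAlgEquiv)
open Literature.NumberTheory.EllipticCurves

variable (K : Type) [Field K] [NumberField K]

/-- **Restriction to a normal number field.** For `K/ℚ` normal there is a group homomorphism
`r : Γ_ℚ → Gal(K/ℚ)` such that every `ρ ∈ Γ_ℚ` acts on the embedded copy `e⁻¹(K) ⊂ ℚ̄` of `K`
(`e : ℚ̄ ≃ K̄` the tree's identification `algEquivOfEmb K (closureEmb K)`, as in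
`exists_resGal_eq_of_forall_apply_eq`) through `r ρ`: `ρ(ι x) = ι(r ρ x)`. This is Mathlib's
`AlgEquiv.restrictNormalHom` for the algebra structure `K → ℚ̄` given by `ι`.
Serre, *Galois Cohomology*, II.§1.1; Milne, *Fields and Galois Theory*, §7. [folklore] -/
theorem exists_restrictNormalHom [Normal ℚ K] :
    ∃ r : absoluteGaloisGroup ℚ →* (K ≃ₐ[ℚ] K), ∀ (ρ : absoluteGaloisGroup ℚ) (x : K),
      toAlgEquiv ℚ ρ ((algEquivOfEmb K (closureEmb (K := ℚ) K)).symm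
          (algebraMap K (AlgebraicClosure K) x)) =
        (algEquivOfEmb K (closureEmb (K := ℚ) K)).symm
          (algebraMap K (AlgebraicClosure K) (r ρ x)) := by
  let ι : K →ₐ[ℚ] AlgebraicClosure ℚ :=
    (algEquivOfEmb K (closureEmb (K := ℚ) K)).symm.toAlgHom.comp
      (algebraMap K (AlgebraicClosure K)).toRatAlgHom
  have hι : ∀ x : K, ι x = (algEquivOfEmb K (closureEmb (K := ℚ) K)).symm
      (algebraMap K (AlgebraicClosure K) x) := fun _ ↦ rfl
  letI : Algebra K (AlgebraicClosure ℚ) := ι.toRingHom.toAlgebra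
  have halg : ∀ x : K, algebraMap K (AlgebraicClosure ℚ) x = ι x := fun _ ↦ rfl
  haveI : IsScalarTower ℚ K (AlgebraicClosure ℚ) :=
    IsScalarTower.of_algebraMap_eq fun q ↦ by rw [halg, AlgHom.commutes]
  refine ⟨(AlgEquiv.restrictNormalHom K).comp (toAlgEquiv ℚ).toMonoidHom, fun ρ x ↦ ?_⟩
  have h := AlgEquiv.restrictNormal_commutes (toAlgEquiv ℚ ρ) K x
  rw [halg, halg, hι, hι] at h
  exact h.symm

end Galois

end Summit.BirchSwinnertonDyer.Rank1Residual.Additive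

end
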